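import Summits.QuantumAdvantage.QuantumAdvantage.Theorems.CubicForrelationNearExactIsExactAmmCeilingY

/-!
# Crux `CubicForrelation.NearExactIsExact` (stmt-QuantumAdvantage-14043) — almost-MM ceiling, part W:
the second wall — every corner lies in its fibre

Line `direct-sum-amplification`, lead c3 (fourth helper file for the registered stub `stub_ammCeiling`).
With the notation of parts Q, X, Y (`B x₁ i j` the polar entries of the slice `f(x₁‖·)`, affine in `x₁`;
`d x₁ j = f(x₁‖e_j) ⊕ f(x₁‖0)`; rows `r_p = (B_{pj})_j`; corner `(σ,τ) ↦ a′ ⊕ σ r_p ⊕ τ r_q`,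
`a′_j = d_j ⊕ B_{pj}B_{qj}`): if Plücker holds everywhere, all slices are quadratic, `φ` is coordinatewise
quadratic and fewer than `2^a/32` fibres are bad, then `φ(corner) = x₁` whenever `B_{pq}(x₁) = 1`
(`acy_corner_mem`).  The indicator `B_{pq}(x₁)·[φ(corner(x₁))_i ≠ (x₁)_i]` has degree `≤ 5` in `x₁` and vanishes
at good fibres: there the corners are the Walsh support of the slice, which by the four-point lemma is the fibre.

References: C. Carlet, *Boolean Functions for Cryptography and Coding Theory* (CUP 2021), §5.1;
F. J. MacWilliams, N. J. A. Sloane, *The Theory of Error-Correcting Codes* (1977), Ch. 13.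
-/

set_option linter.dupNamespace false -- D-0017: single-problem summit ⇒ `QuantumAdvantage.QuantumAdvantage` by design

noncomputable section

namespace Summit.QuantumAdvantage.QuantumAdvantage.Theorems.CubicForrelation.NearExactIsExact

open Finset
open Literature.Computability.QuantumComplexity
open Literature.Computability.QuantumComplexity.BuzetChailloux (bxor zeroVec signOf_sq bxor_zeroVec zeroVec_bxor
  bxor_comm bxor_self bxor_bxor_cancel_left twist_zeroVec_right twist_bxor_right sum_twist_left bxor_eq_zeroVec_iff)
open Literature.Computability.QuantumComplexity.DerivativeWalsh (W signOf_not)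

variable {a : ℕ}

/-! ### The second wall: every corner lies in its fibre -/

/-- Corner bookkeeping: the four values of `(σ, τ)` give the four corners `a′ ⊕ σ r_p ⊕ τ r_q`. [folklore] -/
theorem acy_corner_cases {k : ℕ} (a' rp rq : Fin k → Bool) (σ τ : Bool) :
    (fun j => a' j ^^ (σ && rp j) ^^ (τ && rq j)) ∈ ({a', bxor a' rp, bxor a' rq, bxor a' (bxor rp rq)} : Finset (Fin k → Bool)) := by
  simp only [mem_insert, mem_singleton]
  cases σ <;> cases τ
  · left; funext j; simp
  · right; right; left; funext j; simp [bxor]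
  · right; left; funext j; simp [bxor]
  · right; right; right; funext j; simp [bxor]

/-- **Second wall: corners lie in fibres.** Notation: `B x₁ i j` the polar entries of the slice `f(x₁‖·)` (affine in
`x₁`), `d x₁ j = f(x₁‖e_j) ⊕ f(x₁‖0)` (degree `≤ 2`), corner `(σ,τ) ↦ a′ ⊕ σ r_p ⊕ τ r_q` with
`a′_j = d_j ⊕ B_{pj}B_{qj}`, `r_p = (B_{pj})_j`.  If Plücker holds everywhere, all slices are quadratic, `φ` is
coordinatewise quadratic and fewer than `2^a/32` fibres are bad, then `φ(corner) = x₁` whenever `B_{pq}(x₁) = 1`: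
the indicator `B_{pq}(x₁)·[φ(corner(x₁))_i ≠ (x₁)_i]` has degree `≤ 5` and vanishes at good fibres (there the
corners are the Walsh support of the slice, which by the four-point lemma is the fibre). -/
theorem acy_corner_mem
    (hFP : ∀ (k : ℕ) (c : (Fin k → Bool) → Bool) (y₁ y₂ y₃ y₄ : Fin k → Bool), IsDegLeFun 3 c →
      y₁ ≠ y₂ → y₁ ≠ y₃ → y₁ ≠ y₄ → y₂ ≠ y₃ → y₂ ≠ y₄ → y₃ ≠ y₄ →
      (15 / 8 : ℝ) * (2 : ℝ) ^ k < |W (fun x => signOf (c x)) y₁| + |W (fun x => signOf (c x)) y₂| +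
        |W (fun x => signOf (c x)) y₃| + |W (fun x => signOf (c x)) y₄| →
      ∃ (s u v : Fin k → Bool) (e : Bool), u ≠ zeroVec ∧ v ≠ zeroVec ∧ u ≠ v ∧
        (∀ x, signOf (c x) = signOf e * twist s x * ((1 + twist u x + twist v x - twist u x * twist v x) / 2)) ∧
        ({y₁, y₂, y₃, y₄} : Finset (Fin k → Bool)) = {s, bxor s u, bxor s v, bxor s (bxor u v)})
    (l : (Fin (a + 2) → Bool) → (Fin (a + 2) → Bool) → Bool) (hl : ∀ y x, signOf (l y x) = twist x y)
    {f : (Fin (a + (a + 2)) → Bool) → Bool} (hf : IsDegLeFun 3 f) (φ : (Fin (a + 2) → Bool) → (Fin a → Bool))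
    (hφ : ∀ i, IsDegLeFun 2 (fun y => φ y i)) (h : (Fin (a + 2) → Bool) → Bool)
    (B : (Fin a → Bool) → Fin (a + 2) → Fin (a + 2) → Bool)
    (hB : ∀ x₁ i j, B x₁ i j = (f (Fin.append x₁ zeroVec) ^^ f (Fin.append x₁ (Pi.single i true)) ^^
      f (Fin.append x₁ (Pi.single j true)) ^^ f (Fin.append x₁ (bxor (Pi.single i true) (Pi.single j true)))))
    (d : (Fin a → Bool) → Fin (a + 2) → Bool)
    (hd : ∀ x₁ j, d x₁ j = (f (Fin.append x₁ (Pi.single j true)) ^^ f (Fin.append x₁ zeroVec)))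
    (hbad : (univ.filter fun x₁ : Fin a → Bool => ¬ ((univ.filter fun y : Fin (a + 2) → Bool => φ y = x₁).card = 4 ∧
        ∀ y : Fin (a + 2) → Bool, φ y = x₁ →
          signOf (h y) * W (fun x₂ => signOf (f (Fin.append x₁ x₂))) y = (2 : ℝ) ^ (a + 2) / 2)).card * 32 < 2 ^ a)
    (hPl : ∀ x₁ i j i' j', ((B x₁ i j && B x₁ i' j') ^^ (B x₁ i i' && B x₁ j j') ^^ (B x₁ i j' && B x₁ j i')) = false)
    (hq : ∀ x₁, IsDegLeFun 2 (fun x₂ : Fin (a + 2) → Bool => f (Fin.append x₁ x₂)))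
    (x₁ : Fin a → Bool) (p q : Fin (a + 2)) (hpq : B x₁ p q = true) (σ τ : Bool) :
    φ (fun j => (d x₁ j ^^ (B x₁ p j && B x₁ q j)) ^^ (σ && B x₁ p j) ^^ (τ && B x₁ q j)) = x₁ := by
  -- degrees in x₁
  have hBdeg : ∀ i j, IsDegLeFun 1 (fun x => B x i j) := fun i j =>
    rm_isDegLeFun_congr (acx_deg_polar hf (Pi.single i true) (Pi.single j true)) fun x => (hB x i j).symm
  have hddeg : ∀ j, IsDegLeFun 2 (fun x => d x j) := fun j =>
    rm_isDegLeFun_congr (acx_deg_first hf (Pi.single j true)) fun x => (hd x j).symm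
  have hcdeg : ∀ j, IsDegLeFun 2 (fun x => (d x j ^^ (B x p j && B x q j)) ^^ (σ && B x p j) ^^ (τ && B x q j)) :=
    fun j => fc_deg_bxor (fc_deg_bxor (fc_deg_bxor (hddeg j) (acq_deg_band (hBdeg p j) (hBdeg q j) le_rfl))
      (acq_deg_band (isDegLeFun_const 0 σ) (hBdeg p j) (by norm_num)))
      (acq_deg_band (isDegLeFun_const 0 τ) (hBdeg q j) (by norm_num))
  -- the structure of the slice at any x with B x p q = 1 (Plücker normal form)
  have hnf : ∀ x, B x p q = true → ∀ x₂, f (Fin.append x x₂) =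
      ((l (fun j => B x p j) x₂ && l (fun j => B x q j) x₂) ^^ l (fun j => d x j ^^ (B x p j && B x q j)) x₂ ^^
        f (Fin.append x zeroVec)) := by
    intro x hx
    have hP' := hPl x
    simp only [hB] at hP'
    have hx' := hx
    rw [hB] at hx'
    have nf := acq_normalForm (c := fun x₂ => f (Fin.append x x₂)) l (hq x) hl p q hP' hx'
    have hrow : ∀ i, (fun j => f (Fin.append x zeroVec) ^^ f (Fin.append x (Pi.single i true)) ^^
        f (Fin.append x (Pi.single j true)) ^^ f (Fin.append x (bxor (Pi.single i true) (Pi.single j true)))) =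
        fun j => B x i j := fun i => funext fun j => (hB x i j).symm
    have ha : (fun j => f (Fin.append x (Pi.single j true)) ^^ f (Fin.append x zeroVec) ^^
        ((f (Fin.append x zeroVec) ^^ f (Fin.append x (Pi.single p true)) ^^ f (Fin.append x (Pi.single j true)) ^^
            f (Fin.append x (bxor (Pi.single p true) (Pi.single j true)))) &&
          (f (Fin.append x zeroVec) ^^ f (Fin.append x (Pi.single q true)) ^^ f (Fin.append x (Pi.single j true)) ^^
            f (Fin.append x (bxor (Pi.single q true) (Pi.single j true)))))) =
        fun j => d x j ^^ (B x p j && B x q j) := funext fun j => by rw [hd, hB, hB]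
    rw [hrow p, hrow q, ha] at nf
    exact nf
  have hBsymm : ∀ x i j, B x i j = B x j i := fun x i j => by
    rw [hB, hB, bxor_comm (Pi.single i true)]
    cases f (Fin.append x zeroVec) <;> cases f (Fin.append x (Pi.single i true)) <;> cases f (Fin.append x (Pi.single j true)) <;>
      cases f (Fin.append x (bxor (Pi.single j true) (Pi.single i true))) <;> decide
  have hBdiag : ∀ x i, B x i i = false := fun x i => by
    rw [hB, bxor_self]; cases f (Fin.append x zeroVec) <;> cases f (Fin.append x (Pi.single i true)) <;> decide
  -- the wall, coordinate by coordinate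
  funext i
  set E : (Fin a → Bool) → Bool := fun x =>
    B x p q && (φ (fun j => (d x j ^^ (B x p j && B x q j)) ^^ (σ && B x p j) ^^ (τ && B x q j)) i ^^ x i) with hE
  have hEdeg : IsDegLeFun 5 E := by
    refine acq_deg_band (hBdeg p q) (fc_deg_bxor (d := 4) ?_ (isDegLeFun_apply i (by norm_num))) (by norm_num)
    exact fc_isDegLeFun_comp (hφ i) (fun x => fun j => (d x j ^^ (B x p j && B x q j)) ^^ (σ && B x p j) ^^ (τ && B x q j))
      (fun j => hcdeg j) (by norm_num)
  have hgood : ∀ x, E x = true → x ∈ (univ.filter fun x₁ : Fin a → Bool =>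
      ¬ ((univ.filter fun y : Fin (a + 2) → Bool => φ y = x₁).card = 4 ∧
        ∀ y : Fin (a + 2) → Bool, φ y = x₁ →
          signOf (h y) * W (fun x₂ => signOf (f (Fin.append x₁ x₂))) y = (2 : ℝ) ^ (a + 2) / 2)) := by
    intro x hx
    rw [mem_filter]
    refine ⟨mem_univ _, fun hG => ?_⟩
    -- at a good fibre with B x p q = 1 the corner lies in the fibre, so E x = false
    have hxpq : B x p q = true := by
      revert hx; simp only [hE]; cases B x p q <;> simp
    obtain ⟨s, u, v, e, hu, hv, huv, hc, hfib⟩ := acx_good_structure hFP l hl hf φ h x hG.1 hG.2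
    -- Walsh modulus from the four-point form and from the normal form
    have hW1 := acy_W_aligned_abs l hl hc hu hv huv
      (fun j => (d x j ^^ (B x p j && B x q j)) ^^ (σ && B x p j) ^^ (τ && B x q j))
    have hu' : (fun j => B x p j) ≠ zeroVec := fun h0 => by
      have := congrFun h0 q; rw [hxpq] at this; exact Bool.noConfusion this
    have hv' : (fun j => B x q j) ≠ zeroVec := fun h0 => by
      have := congrFun h0 p; rw [hBsymm x q p, hxpq] at this; exact Bool.noConfusion this
    have huv' : (fun j => B x p j) ≠ (fun j => B x q j) := fun h0 => by
      have := congrFun h0 p; rw [hBdiag x p, hBsymm x q p, hxpq] at this; exact Bool.noConfusion this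
    have hW2 := acy_W_aligned_abs l hl (hnf x hxpq) hu' hv' huv'
      (fun j => (d x j ^^ (B x p j && B x q j)) ^^ (σ && B x p j) ^^ (τ && B x q j))
    rw [if_pos (acy_corner_cases _ _ _ σ τ)] at hW2
    have hmem : (fun j => (d x j ^^ (B x p j && B x q j)) ^^ (σ && B x p j) ^^ (τ && B x q j)) ∈
        ({s, bxor s u, bxor s v, bxor s (bxor u v)} : Finset (Fin (a + 2) → Bool)) := by
      by_contra hn
      rw [if_neg hn] at hW1
      rw [hW1] at hW2
      have : (0 : ℝ) < 2 ^ (a + 2) / 2 := by positivity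
      linarith
    rw [← hfib, mem_filter] at hmem
    have : E x = false := by
      simp only [hE, hmem.2, Bool.xor_self, Bool.and_false]
    rw [this] at hx
    exact Bool.false_ne_true hx
  have hEx := acx_wall hEdeg _ hgood (by simpa [show (2:ℕ) ^ 5 = 32 by norm_num] using hbad) x₁
  simp only [hE, hpq, Bool.true_and] at hEx
  revert hEx
  cases φ (fun j => (d x₁ j ^^ (B x₁ p j && B x₁ q j)) ^^ (σ && B x₁ p j) ^^ (τ && B x₁ q j)) i <;> cases x₁ i <;> simp

/-- Corner bookkeeping (registered helper-stub form of `acy_corner_cases`). [folklore] -/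
theorem acy_cornerCasesStub : ∀ {k : ℕ} (a' rp rq : Fin k → Bool) (σ τ : Bool), (fun j => a' j ^^ (σ && rp j) ^^ (τ && rq j)) ∈ ({a', bxor a' rp, bxor a' rq, bxor a' (bxor rp rq)} : Finset (Fin k → Bool)) := by
  intro k a' rp rq σ τ
  exact acy_corner_cases a' rp rq σ τ

end Summit.QuantumAdvantage.QuantumAdvantage.Theorems.CubicForrelation.NearExactIsExact

end
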